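import Literature.NumberTheory.LFunctions.ZetaSpacingDensityRHProofs
import Literature.NumberTheory.LFunctions.MontgomerySmallGapsProofs
import HarnessLib

/-!
# Montgomery 1973, Corollary 3, POSITIVE-PROPORTION form: on RH, `μ_D ≤ 0.68` (Montgomery's triangle kernel in Bui–Goldston–Milinovich–Montgomery's Theorem 3)

Topic `Literature/NumberTheory/LFunctions` (namespace `Literature.NumberTheory.LFunctions`, proof objects in
`Montgomery1973` and `BGMM2023`). PROOF LAYER (cell `landau-siegel`, §C literature harvest, seat ls-lit-r2 g5;
records row of `lit/r2/SYNTHESIS.md` §2 row 3 / K_ell EDLIST ell-E10): THEOREMS ONLY — no definitions, no named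
facts, no new hypotheses. The "infinitely often" form (8) of Montgomery's Corollary 3 is ALREADY discharged in the
tree (`Literature.NumberTheory.LFunctions.montgomery1973_corollary3_holds`, `MontgomerySmallGapsProofs.lean`, cell
rh-crit/ah, by the printed contradiction argument). This file proves the STRONGER form Montgomery announced
without proof right after (8) (H. L. Montgomery, *The pair correlation of zeros of the zeta function*, Proc.
Sympos. Pure Math. 24 (1973) 181–193, p. 182, read in the reprint Borwein–Choi–Rooney–Weirathmueller, *The
Riemann Hypothesis — a resource for the afficionado and virtuoso alike*, Springer 2008):

> "A complicated argument would permit one to show that in fact `γ_{n+1} − γ_n ≤ 2πλ/log γ_n` for a positive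
> density of `n`. … Our proof allows us to take `λ = 0.68`."

and §4: "We take `r(u) = max(1 − (|u|/λ), 0)` in (3) … Now `r̂(α)` is nonnegative … `C(λ) = λ + (1/π²λ)
Cin(2πλ) − 1` … In fact a little calculation reveals that `C(0.68) > 0`."

The "complicated argument" is, fifty years on, Bui–Goldston–Milinovich–Montgomery 2023, Theorem 3 (first
clause) — a KERNEL THEOREM of the tree (`Literature.NumberTheory.LFunctions.buiEtAl2023_theorem3_holds`, engine
`BGMM2023.spacingDensityPos_of_RH`, `ZetaSpacingDensityRHProofs.lean`): RH and `c(λ;r) > 0` for some `r` in the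
class `𝒜(λ)` (`BGMM2023.IsAdmissible`: even, continuous, `L¹`, `r(0) = 1`, `r ≤ 0` off `[−λ, λ]`, `r̂ ≥ 0`)
give `lim inf_T D(λ,T) > 0`. Montgomery's triangle IS in `𝒜(λ)` and its criterion constant
`c(λ;r) = r̂(0) − 1 + 2∫₀¹ α r̂(α) dα` (`BGMM2023.cValue`) IS Montgomery's `C(λ)` (`r̂(α) = λ (sin πλα/πλα)²`);
and "`C(0.68) > 0`" is the tree's certified `MontgomerySmallGaps.criterion_068`. Everything here is assembly of
tree theorems; in particular this file exhibits the first concrete member of the typed class `𝒜(λ)`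
(non-vacuity of `BGMM2023.IsAdmissible`) and the first KERNEL-PROVED positive-proportion small-gap record under
RH (`0.68`; the printed records `0.6039` etc. are typed facts, `buiEtAl2023_theorem1` ff.).

## What is proved (all inputs are tree theorems; RH is Mathlib's `RiemannHypothesis`, explicit)

* `Montgomery1973.triangle_eq_fejerTest` — `max(1 − |u|/λ, 0) = λ · g_{λ,0}(u)` with the tree's normalised
  triangle `AH.fejerTest` (`AlternativeHypothesisFormFactorProofs.lean`), whence continuity, integrability and
  `Montgomery1973.cosTransform_triangle`: `r̂(α) = λ · sinc(πλα)²` (the tree's `AH.fourier_fejerTest` and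
  `BGMM2023.fourier_ofReal_eq_cosTransform`); `Montgomery1973.isAdmissible_triangle`: `r_λ ∈ 𝒜(λ)`.
* `Montgomery1973.cValue_triangle` — `c(λ;r_λ) = λ − 1 + 2λ ∫₀¹ α sinc(πλα)² dα` (`= C(λ)`), and
  `Montgomery1973.cValue_triangle_pos`: `C(0.68) > 0` (from `MontgomerySmallGaps.criterion_068`).
* `Montgomery1973.spacingDensityPos_of_RH` — **RH ⇒ for some `A > 0` and all large `T`, at least `A · N(T)`
  indices `n < N(T)` have `γ_{n+1} − γ_n ≤ 2π · 0.68/log T`** (`BGMM2023.SpacingDensityPos 0.68`), and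
  `Montgomery1973.muDLe_of_RH`: RH ⇒ `μ_D ≤ 0.68` (`BGMM2023.MuDLe 0.68`).
* `BGMM2023.SpacingDensityPos.frequently_zetaNormalizedGap_le`, `BGMM2023.SpacingDensityPos.zetaGapLiminfLe`,
  `BGMM2023.MuDLe.zetaGapLiminfLe` — the bookkeeping "`μ ≤ μ_D`" of Bui–Goldston–Milinovich–Montgomery 2023, §1,
  between the tree's two record vocabularies (`ZetaSpacingDensityRH.lean` ↔ `ZetaGapRecordsRH.lean`): a positive
  proportion for all large `T` gives `δ_n = (γ_{n+1} − γ_n) log γ_n/2π ≤ λ` infinitely often, hence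
  `lim inf δ_n ≤ λ` (`ZetaGapLiminfLe`).
* `Montgomery1973.zetaGapLiminfLe_of_muDLe` — (8) with `λ = 0.68` re-obtained from the positive-proportion form
  (the tree's discharge `montgomery1973_corollary3_holds` is the reference proof of (8); not restated here).

No knife edge of the Landau–Siegel programme moves (`0.68 > ½`; RH is a hypothesis): the tree's bridge
`BGMM2023.subnormalGapsHypothesis_of_gapDensityPos` to Conrey–Iwaniec's (1.22) needs `λ < ½`. LABEL: **NOT
RH-BEARING** (RH is displayed as the antecedent, never asserted). «The programme SEARCHES and TYPES; no claim about
Landau–Siegel zeros, Theorems 1–2 of arXiv:2211.02515 or a repaired Margin232 until a kernel theorem says so.»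

## References

* [Montgomery1973] H. L. Montgomery, Proc. Sympos. Pure Math. 24 (1973) 181–193: Corollary 3, eq. (8) and the
  remark following it, p. 182; §4 "The corollaries" (the triangle kernel, `C(λ)`, `C(0.68) > 0`).
* [BuiEtAl2023] H. M. Bui, D. A. Goldston, M. B. Milinovich, H. L. Montgomery, Acta Arith. 210 (2023) 133–153
  (arXiv:2208.02359): §1 ("μ ≤ μ_D ≤ μ_{D_d}", definition of `D(λ,T)`, `μ_D`), §2 class `𝒜(λ)` and (2.3),
  Theorem 3.
* [BaluyotGoldstonSuriajayaTurnageButterbaugh2025] arXiv:2508.10857, §5 (k_λ), (K-Fejer) — the tree's Fejér pair.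
-/

noncomputable section

open Filter Set MeasureTheory Real Finset
open scoped Topology FourierTransform

namespace Literature.NumberTheory.LFunctions

namespace Montgomery1973

/-! ## §1. Montgomery's kernel `r_λ(u) = max(1 − |u|/λ, 0)` is in the class `𝒜(λ)` -/

/-- `max(1 − |u|/λ, 0) = λ · g_{λ,0}(u)` with `g_{λ,0}(u) = λ⁻² max(λ − |u|, 0)` the tree's normalised triangle.
[cite: Montgomery1973, §4 (proof of Corollary 3)] -/
theorem triangle_eq_fejerTest {lam : ℝ} (hlam : 0 < lam) (u : ℝ) :
    max (1 - |u| / lam) 0 = lam * AH.fejerTest lam 0 u := by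
  unfold AH.fejerTest
  rw [sub_zero]
  rcases le_or_gt (|u|) lam with h | h
  · have h1 : 0 ≤ 1 - |u| / lam := by
      rw [sub_nonneg, div_le_one hlam]
      exact h
    rw [max_eq_left h1, max_eq_left (by linarith)]
    field_simp
  · have h1 : 1 - |u| / lam ≤ 0 := by
      rw [sub_nonpos, one_le_div hlam]
      exact h.le
    rw [max_eq_right h1, max_eq_right (by linarith), mul_zero, mul_zero]

/-- The kernel as a function equals `λ · g_{λ,0}`. [cite: Montgomery1973, §4 (proof of Corollary 3)] -/
theorem triangle_eq_fejerTest' {lam : ℝ} (hlam : 0 < lam) :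
    (fun u : ℝ ↦ max (1 - |u| / lam) 0) = fun u ↦ lam * AH.fejerTest lam 0 u :=
  funext (triangle_eq_fejerTest hlam)

/-- `r_λ` is continuous. [cite: Montgomery1973, §4 (proof of Corollary 3)] -/
theorem continuous_triangle {lam : ℝ} (hlam : 0 < lam) : Continuous fun u : ℝ ↦ max (1 - |u| / lam) 0 := by
  rw [triangle_eq_fejerTest' hlam]
  exact continuous_const.mul (AH.continuous_fejerTest lam 0)

/-- `r_λ ∈ L¹`. [cite: Montgomery1973, §4 (proof of Corollary 3)] -/
theorem integrable_triangle {lam : ℝ} (hlam : 0 < lam) : Integrable fun u : ℝ ↦ max (1 - |u| / lam) 0 := by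
  rw [triangle_eq_fejerTest' hlam]
  exact (AH.integrable_fejerTest lam 0).const_mul lam

/-- `g_{λ,0}` is even. [cite: BaluyotGoldstonSuriajayaTurnageButterbaugh2025, §5 (k_λ)] -/
theorem fejerTest_zero_even (lam v : ℝ) : AH.fejerTest lam 0 (-v) = AH.fejerTest lam 0 v := by
  unfold AH.fejerTest
  rw [sub_zero, sub_zero, abs_neg]

/-- **`r̂_λ(α) = λ (sin πλα/πλα)²`** ("Now `r̂(α)` is nonnegative"): the cosine transform of the triangle is the
Fejér kernel on the line — from the tree's `AH.fourier_fejerTest`. [cite: Montgomery1973, §4 (proof of Corollary 3)] -/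
theorem cosTransform_triangle {lam : ℝ} (hlam : 0 < lam) (α : ℝ) :
    BGMM2023.cosTransform (fun u : ℝ ↦ max (1 - |u| / lam) 0) α = lam * Real.sinc (π * lam * α) ^ 2 := by
  have h1 : BGMM2023.cosTransform (fun u : ℝ ↦ max (1 - |u| / lam) 0) α =
      lam * BGMM2023.cosTransform (AH.fejerTest lam 0) α := by
    unfold BGMM2023.cosTransform
    rw [← integral_const_mul]
    refine integral_congr_ae (Eventually.of_forall fun u ↦ ?_)
    dsimp only
    rw [triangle_eq_fejerTest hlam]
    ring
  have h2 : ((BGMM2023.cosTransform (AH.fejerTest lam 0) α : ℝ) : ℂ) =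
      ((Real.sinc (π * lam * α) ^ 2 : ℝ) : ℂ) := by
    rw [← BGMM2023.fourier_ofReal_eq_cosTransform (fejerTest_zero_even lam) (AH.integrable_fejerTest lam 0) α,
      AH.fourier_fejerTest hlam 0 α]
    have : ((-2 * π * 0 * α : ℝ) : ℂ) * Complex.I = 0 := by push_cast; ring
    rw [this, Complex.exp_zero, one_mul]
  rw [h1, Complex.ofReal_inj.mp h2]

/-- **Montgomery's kernel is admissible**: `r_λ ∈ 𝒜(λ)` — even, continuous, `L¹`, `r(0) = 1`, `r(u) ≤ 0` for
`|u| > λ` (it vanishes there), `r̂ ≥ 0`. [cite: Montgomery1973, §4 (proof of Corollary 3)] -/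
theorem isAdmissible_triangle {lam : ℝ} (hlam : 0 < lam) :
    BGMM2023.IsAdmissible (fun u : ℝ ↦ max (1 - |u| / lam) 0) lam where
  even u := by simp only [abs_neg]
  continuous := continuous_triangle hlam
  integrable := integrable_triangle hlam
  map_zero := by simp
  nonpos u hu := by
    have h1 : 1 - |u| / lam ≤ 0 := by
      rw [sub_nonpos, one_le_div hlam]
      exact hu.le
    simp only [max_eq_right h1, le_refl]
  transform_nonneg α := by
    rw [cosTransform_triangle hlam]
    positivity

/-- **`c(λ; r_λ) = C(λ) = λ − 1 + 2λ ∫₀¹ α (sin πλα/πλα)² dα`** (`= λ + Cin(2πλ)/(π²λ) − 1`).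
[cite: Montgomery1973, §4 (proof of Corollary 3, definition of C(λ))] -/
theorem cValue_triangle {lam : ℝ} (hlam : 0 < lam) :
    BGMM2023.cValue (fun u : ℝ ↦ max (1 - |u| / lam) 0) =
      lam - 1 + 2 * (lam * ∫ α in (0 : ℝ)..1, α * Real.sinc (π * lam * α) ^ 2) := by
  unfold BGMM2023.cValue
  have h0 : BGMM2023.cosTransform (fun u : ℝ ↦ max (1 - |u| / lam) 0) 0 = lam := by
    rw [cosTransform_triangle hlam, mul_zero, Real.sinc_zero, one_pow, mul_one]
  have h1 : (∫ α in (0 : ℝ)..1, α * BGMM2023.cosTransform (fun u : ℝ ↦ max (1 - |u| / lam) 0) α) =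
      lam * ∫ α in (0 : ℝ)..1, α * Real.sinc (π * lam * α) ^ 2 := by
    rw [← intervalIntegral.integral_const_mul]
    refine intervalIntegral.integral_congr fun α _ ↦ ?_
    simp only [cosTransform_triangle hlam]
    ring
  rw [h0, h1]

/-! ## §2. "A little calculation reveals that `C(0.68) > 0`" (the tree's certified `criterion_068`) -/

/-- **`C(0.68) > 0`**: Montgomery's criterion constant for the triangle of width `0.68` is positive —
`C(0.68) = 0.68 (1 + 2∫₀¹ α sinc(0.68πα)² dα) − 1 > 0` is the tree's certified
`MontgomerySmallGaps.criterion_068` (`MontgomerySmallGapsProofs.lean`; true value `0.0087…`).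
[cite: Montgomery1973, §4 (proof of Corollary 3)] -/
theorem cValue_triangle_pos : 0 < BGMM2023.cValue (fun u : ℝ ↦ max (1 - |u| / 0.68) 0) := by
  rw [cValue_triangle (by norm_num)]
  have h := MontgomerySmallGaps.criterion_068
  linarith

/-! ## §3. Assembly: RH ⇒ a positive proportion of gaps `≤ 0.68` mean spacings ⇒ `lim inf δ_n ≤ 0.68` -/

/-- **RH ⇒ `lim inf_T D(0.68, T) > 0`**: on RH, for some `A > 0` and all large `T`, at least `A · N(T)` indices
`n < N(T)` have `γ_{n+1} − γ_n ≤ 2π · 0.68/log T` — Bui–Goldston–Milinovich–Montgomery's Theorem 3 (tree theorem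
`BGMM2023.spacingDensityPos_of_RH`) fed with Montgomery's own kernel ("A complicated argument would permit one to
show that in fact `γ_{n+1} − γ_n ≤ 2πλ/log γ_n` for a positive density of `n`").
[cite: Montgomery1973, Corollary 3 and the remark after (8), p. 182] -/
theorem spacingDensityPos_of_RH (hRH : RiemannHypothesis) : BGMM2023.SpacingDensityPos 0.68 :=
  BGMM2023.spacingDensityPos_of_RH hRH (by norm_num) (isAdmissible_triangle (by norm_num)) cValue_triangle_pos

/-- **RH ⇒ `μ_D ≤ 0.68`** in Bui–Goldston–Milinovich–Montgomery's notation. [cite: Montgomery1973, Corollary 3, p. 182] -/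
theorem muDLe_of_RH (hRH : RiemannHypothesis) : BGMM2023.MuDLe 0.68 :=
  fun _ hlam ↦ (spacingDensityPos_of_RH hRH).mono hlam.le

end Montgomery1973

namespace BGMM2023

/-- **From a positive proportion to "infinitely often"**: if `lim inf_T D(λ,T) > 0` (`λ ≥ 0`), then
`δ_n = (γ_{n+1} − γ_n) log γ_n/2π ≤ λ` for infinitely many `n` (each counted index `n < N(T)` has `γ_n ≤ T`, so
`δ_n ≤ λ log γ_n/log T ≤ λ`; and `A · N(T) → ∞` indices cannot all lie below a fixed `N₀`).
[cite: BuiEtAl2023, §1 ("μ ≤ μ_D ≤ μ_{D_d}")] -/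
theorem SpacingDensityPos.frequently_zetaNormalizedGap_le {lam : ℝ} (hlam : 0 ≤ lam)
    (h : SpacingDensityPos lam) : ∃ᶠ n in atTop, zetaNormalizedGap n ≤ lam := by
  obtain ⟨A, hA, T₀, hT₀⟩ := h
  -- the counted indices have `δ_n ≤ λ` once `T ≥ 1`
  have hsub : ∀ T : ℝ, 1 ≤ T → ∀ n ∈ (Finset.range (zetaZeroCount T)).filter
      (fun n ↦ zetaOrdinate (n + 1) - zetaOrdinate n ≤ 2 * π * lam / Real.log T),
      zetaNormalizedGap n ≤ lam := by
    intro T hT1 n hn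
    rw [Finset.mem_filter] at hn
    obtain ⟨hnr, hle⟩ := hn
    have hγT : zetaOrdinate n ≤ T := mem_zeroIndexSet_iff_holds.mp hnr
    have h14 : 14 < zetaOrdinate n :=
      lt_of_lt_of_le fourteen_lt_zetaOrdinate_zero_holds (zetaOrdinate_mono_holds (Nat.zero_le n))
    have hγ1 : 1 < zetaOrdinate n := by linarith
    have hlogγ : 0 < Real.log (zetaOrdinate n) := Real.log_pos hγ1
    have hlogT : Real.log (zetaOrdinate n) ≤ Real.log T := Real.log_le_log (by linarith) hγT
    have hlogT0 : 0 < Real.log T := lt_of_lt_of_le hlogγ hlogT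
    rw [zetaNormalizedGap_eq_mul_div, div_le_iff₀ (by positivity)]
    calc (zetaOrdinate (n + 1) - zetaOrdinate n) * Real.log (zetaOrdinate n)
        ≤ 2 * π * lam / Real.log T * Real.log (zetaOrdinate n) :=
          mul_le_mul_of_nonneg_right hle hlogγ.le
      _ ≤ 2 * π * lam / Real.log T * Real.log T := by gcongr
      _ = lam * (2 * π) := by field_simp
  by_contra hnot
  rw [Filter.not_frequently, Filter.eventually_atTop] at hnot
  obtain ⟨N₀, hN₀⟩ := hnot
  -- every counted index is `< N₀`, so the count is `≤ N₀` for `T ≥ max T₀ 1`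
  have hcard : ∀ T : ℝ, 1 ≤ T → (spacingCount lam T : ℝ) ≤ N₀ := by
    intro T hT1
    unfold spacingCount
    have hs : (Finset.range (zetaZeroCount T)).filter
        (fun n ↦ zetaOrdinate (n + 1) - zetaOrdinate n ≤ 2 * π * lam / Real.log T) ⊆ Finset.range N₀ := by
      intro n hn
      rw [Finset.mem_range]
      by_contra hge
      exact hN₀ n (not_lt.mp hge) (hsub T hT1 n hn)
    exact_mod_cast (Finset.card_le_card hs).trans (Finset.card_range N₀).le
  -- but `A · N(T) → ∞`
  have hN : Tendsto zetaZeroCount atTop atTop := tendsto_zetaZeroCount_atTop_holds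
  obtain ⟨T₁, hT₁⟩ := Filter.eventually_atTop.mp (hN.eventually_ge_atTop (⌈(N₀ : ℝ) / A⌉₊ + 1))
  set T : ℝ := max (max T₀ 1) T₁ with hTdef
  have h1 := hT₀ T ((le_max_left _ _).trans (le_max_left _ _))
  have h2 := hT₁ T (le_max_right _ _)
  have h3 := hcard T ((le_max_right _ _).trans (le_max_left _ _))
  have h4 : (N₀ : ℝ) / A < (zetaZeroCount T : ℝ) := by
    have h5 : (N₀ : ℝ) / A ≤ ⌈(N₀ : ℝ) / A⌉₊ := Nat.le_ceil _
    have h6 : ((⌈(N₀ : ℝ) / A⌉₊ + 1 : ℕ) : ℝ) ≤ (zetaZeroCount T : ℝ) := by exact_mod_cast h2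
    push_cast at h6
    linarith
  have h7 : (N₀ : ℝ) < A * (zetaZeroCount T : ℝ) := by
    rw [div_lt_iff₀ hA] at h4
    linarith
  linarith

/-- **`μ ≤ μ_D`, spacing-density form**: `lim inf_T D(λ,T) > 0` (`λ ≥ 0`) gives `lim inf_n δ_n ≤ λ`
(`ZetaGapLiminfLe λ`). [cite: BuiEtAl2023, §1 ("μ ≤ μ_D ≤ μ_{D_d}")] -/
theorem SpacingDensityPos.zetaGapLiminfLe {lam : ℝ} (hlam : 0 ≤ lam) (h : SpacingDensityPos lam) :
    ZetaGapLiminfLe lam :=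
  fun _ hc' ↦ ⟨lam, hc', h.frequently_zetaNormalizedGap_le hlam⟩

/-- **`μ ≤ μ_D`**: `μ_D ≤ c` (`c ≥ 0`) gives `μ ≤ c`. [cite: BuiEtAl2023, §1 ("μ ≤ μ_D ≤ μ_{D_d}")] -/
theorem MuDLe.zetaGapLiminfLe {c : ℝ} (hc : 0 ≤ c) (h : MuDLe c) : ZetaGapLiminfLe c := by
  intro c' hc'
  obtain ⟨lam, hclam, hlamc'⟩ := exists_between hc'
  have hlam0 : 0 ≤ lam := hc.trans hclam.le
  exact ⟨lam, hlamc', (h lam hclam).frequently_zetaNormalizedGap_le hlam0⟩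

end BGMM2023

/-- **Montgomery's (8) from the positive-proportion form**: the tree's discharge
`montgomery1973_corollary3_holds` (`MontgomerySmallGapsProofs.lean`, cell rh-crit/ah) proves (8) by the printed
contradiction argument; the same statement also drops out of `μ ≤ μ_D ≤ 0.68` — recorded as a remark on the
bookkeeping, under its own name. [cite: Montgomery1973, Corollary 3 with eq. (8) and λ = 0.68, p. 182] -/
theorem Montgomery1973.zetaGapLiminfLe_of_muDLe (hRH : RiemannHypothesis) : ZetaGapLiminfLe 0.68 :=
  (Montgomery1973.muDLe_of_RH hRH).zetaGapLiminfLe (by norm_num)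

end Literature.NumberTheory.LFunctions

end
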